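import Summits.QuantumFields.YangMills.Theorems.SwapVirialDeficitGnomonicSpeed
import Summits.QuantumFields.YangMills.Theorems.SwapVirialDeficitBlowUpGnomonicDefs
import HarnessLib

/-!
# The SPEED of the gnomonic blow-up, part 2 (brick S-B of fcl-p3 g45's virial SPEC): the LEADER letters — transverse dilation of `x, y`, the slaved
# letter `Ā·x̂·A·ẑ`, the hub — move at speed `≤ 1` along `s ↦ blowUpPoint (e^s) (gnomonicPoint a ε η)`
# (free-hands support of ⟨stmt-QuantumFields-24197⟩ `SwapVirialDeficit.SwapGluedStiffness`)

Sequel of ✓`…SwapVirialDeficitGnomonicSpeed` (part 1: the followers ∕ fully dilated letters `su2Quat (quatToSU2 (±(1, e^s v)))` move at speed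
`≤ 1/2`; words add speeds), in the coordinates of fcl-p3 g45's ✓`…BlowUpGnomonicDefs` (`gnoLetter`, `trDil`, `dilate_gnoLetter`, `dilateIm_gnoLetter`):

* §1 ★★ `norm_radialDeriv_le_half_of_inner` — for `⟨p, q⟩ = ‖q‖²`, `q ≠ 0`: `‖‖p‖⁻¹·P_p(p − q)‖ ≤ 1/2` (Pythagoras for ✓`tangentialProj`, Cauchy–Schwarz,
  `x(1−x) ≤ 1/4`) — the general form of part 1's `norm_radialDeriv_le_half` (`q = 1`);
* §2 the TRANSVERSELY dilated letters `x, y` (`(1, trDil (e^s) v) = (1, v₀, 0, 0) + e^s·(0, 0, v₁, v₂)`, orthogonal parts): `hasDerivAt_gnomonicQuat_trDil`,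
  ★★ `hasDerivAt_trDilLetter` (`su2Quat (quatToSU2 (gnoLetter ε (trDil (e^s) v)))` has speed `≤ 1/2`), `hasDerivAt_smulLetter` (part 1 in `gnoLetter` form),
  `abs_gnoSign`;
* §3 the SLAVED letter: `su2Quat_quatToSU2_slaveP_mul` (`su2Quat (quatToSU2 (slaveP A x · z)) = Ā·x̂·A·ẑ` through ✓`radialUnit_mul_left`, ✓`norm_slaveP`),
  ★★ `hasDerivAt_slavedLetter` (speed `≤ 1`: constants `Ā, A`, two letters of speed `≤ 1/2`, part 1's product rule), `su2Quat_quatToSU2_axisUnit`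
  (the hub letter is the constant unit `ν(axisPoint a)`);
* §4 ★★★ `hasDerivAt_leader_speed_le` — for `a ≠ 0`, EVERY leader quaternion `su2Quat (leaderTuple a (dil3 (e^s) ((X, Y), Z)) μ)`, `μ : Fin 4`, along
  `s ↦ blowUpPoint (e^s) (gnomonicPoint a ε η)` is differentiable with `‖d/ds‖ ≤ 1` (cases `hasDerivAt_leader_zero/one/two/three` via
  ✓`BlowUp.leaderTuple_apply`).  With part 1, every link quaternion of `fixHistory (ringConfig χ (blowUpPoint (e^s) (gnomonicPoint a ε η)))` — a word
  of `≤ 3` leaders ∕ followers ∕ constants (✓`contDiff_quatHistory_ringConfig`'s case split) — has speed `≤ 3`; the `O(L⁴)` sum over ✓`BlowUp.qDeficit`'s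
  plaquette ∕ coupling ∕ seam terms (S-B part 3) then gives the explicit `C_L` of the SPEC.

HONEST LABEL: calculus plumbing for the window programme of a DRAFT line; no statement about the ring's deficit; ⟨24197⟩ (window-uniform) ∕ ⟨24194⟩ ∕
⟨24497⟩ OPEN; own crux ⟨22884⟩ OPEN (blocked-on ⟨19935⟩); no crux, rung of record or summit is proved; the Yang–Mills mass gap is NOT proved; no summit is
proved by a line.  THEOREMS ONLY (0 `def`, 0 `sorry`), standard axioms; the series' local `ℍ` instances are NOT needed here.  Width seat ym-line-sfw-p2-w2
g57 (cell ym-idea-1, free hands), `--supports stmt-QuantumFields-24197`.  References: [folklore].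
-/

set_option autoImplicit false

noncomputable section

open Quaternion
open scoped Quaternion RealInnerProductSpace
open Literature.MathematicalPhysics.QuantumLattice
open Literature.Analysis.Calculus (radialUnit radialUnit_def norm_radialUnit tangentialProj tangentialProj_apply tangentialProj_apply_self
  inner_tangentialProj inner_tangentialProj_comm tangentialProj_idem hasFDerivAt_radialUnit)
open Summit.QuantumFields.YangMills.Theorems.SwapTwistDeficit.ToronLog (axisPoint)
open Summit.QuantumFields.YangMills.Theorems.SwapVirialDeficit.ZeroModeSigma (su2Quat_quatToSU2_eq_radialUnit radialUnit_mul_left slaveP slaveP_def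
  norm_slaveP norm_axisUnit dil3 dil3_apply)
open Summit.QuantumFields.YangMills.Theorems.SwapVirialDeficit.BlowUp (leaderTuple)
open Summit.QuantumFields.YangMills.Theorems.SwapVirialDeficit.BlowUpRing (gnoLetter gnoSign gnoLetter_eq gnoSign_sq gnoLetter_ne_zero trDil
  dilate_gnoLetter dilateIm_gnoLetter)

namespace Summit.QuantumFields.YangMills.Theorems.SwapVirialDeficit.Gnomonic

/-! ## §1 The speed of the radial projection along `p = q + (orthogonal part)` -/

/-- ★★ **The general speed bound**: if `⟨p, q⟩ = ‖q‖²` (i.e. `p − q ⊥ q`) and `q ≠ 0`, then `‖‖p‖⁻¹·P_p(p − q)‖ ≤ 1/2` — Pythagoras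
`‖P_p q‖² = ‖q‖² − ⟨p,q⟩²/‖p‖²`, `‖p‖² ≥ ‖q‖²`, and `x(1 − x) ≤ 1/4`. [folklore] -/
theorem norm_radialDeriv_le_half_of_inner {p q : ℍ} (hq : q ≠ 0) (h : ⟪p, q⟫ = ‖q‖ ^ 2) : ‖(‖p‖⁻¹ • tangentialProj p) (p - q)‖ ≤ 1 / 2 := by
  have hq2 : 0 < ‖q‖ ^ 2 := by positivity
  -- `‖p‖² ≥ ‖q‖²` (Cauchy–Schwarz with `⟨p, q⟩ = ‖q‖²`)
  have hpq : ‖q‖ ^ 2 ≤ ‖p‖ ^ 2 := by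
    have hcs := abs_real_inner_le_norm p q
    rw [h, abs_of_pos hq2] at hcs
    have hqpos : 0 < ‖q‖ := norm_pos_iff.2 hq
    nlinarith
  have hp2 : 0 < ‖p‖ ^ 2 := lt_of_lt_of_le hq2 hpq
  have h1 : tangentialProj p (p - q) = -(tangentialProj p q) := by
    rw [map_sub, tangentialProj_apply_self, zero_sub]
  have hsq : ‖tangentialProj p q‖ ^ 2 = ‖q‖ ^ 2 - (‖p‖ ^ 2)⁻¹ * (‖q‖ ^ 2) ^ 2 := by
    rw [← real_inner_self_eq_norm_sq, ← inner_tangentialProj_comm, tangentialProj_idem, inner_tangentialProj, real_inner_self_eq_norm_sq, h]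
    ring
  have hD : ‖(‖p‖⁻¹ • tangentialProj p) (p - q)‖ ^ 2 = (‖p‖ ^ 2)⁻¹ * (‖q‖ ^ 2 - (‖p‖ ^ 2)⁻¹ * (‖q‖ ^ 2) ^ 2) := by
    rw [FunLike.coe_smul, Pi.smul_apply, h1, norm_smul, norm_neg, norm_inv, norm_norm, mul_pow, inv_pow, hsq]
  -- `x(1 − x) ≤ 1/4` with `x = ‖q‖²/‖p‖²`
  set x : ℝ := (‖p‖ ^ 2)⁻¹ * ‖q‖ ^ 2 with hx
  have hD' : ‖(‖p‖⁻¹ • tangentialProj p) (p - q)‖ ^ 2 = x * (1 - x) := by rw [hD, hx]; ring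
  have hle : ‖(‖p‖⁻¹ • tangentialProj p) (p - q)‖ ^ 2 ≤ (1 / 2) ^ 2 := by
    rw [hD']; nlinarith [sq_nonneg (x - 1 / 2)]
  exact (pow_le_pow_iff_left₀ (norm_nonneg _) (by norm_num) two_ne_zero).1 hle

/-! ## §2 The transversely dilated letters `x, y`: `s ↦ (±)(1, v₀, e^s v₁, e^s v₂)` -/

/-- `(1, trDil t v) = (1, v₀, 0, 0) + t·(0, 0, v₁, v₂)`. [folklore] -/
theorem gnomonicQuat_trDil (t : ℝ) (v : Fin 3 → ℝ) :
    gnomonicQuat (trDil t v) = gnomonicQuat ![v 0, 0, 0] + t • (gnomonicQuat v - gnomonicQuat ![v 0, 0, 0]) := by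
  ext <;> simp [gnomonicQuat, trDil]

/-- `⟨(1, trDil t v), (1, v₀, 0, 0)⟩ = ‖(1, v₀, 0, 0)‖²` (the dilated part is orthogonal to the fixed part). [folklore] -/
theorem inner_gnomonicQuat_trDil (t : ℝ) (v : Fin 3 → ℝ) :
    ⟪gnomonicQuat (trDil t v), gnomonicQuat ![v 0, 0, 0]⟫ = ‖gnomonicQuat ![v 0, 0, 0]‖ ^ 2 := by
  rw [← real_inner_self_eq_norm_sq, Quaternion.inner_def, Quaternion.inner_def]
  simp [gnomonicQuat, trDil]

/-- ★ The transversely dilated gnomonic path is differentiable: `d/ds (1, trDil (e^s) v) = (1, trDil (e^s) v) − (1, v₀, 0, 0)`. [folklore] -/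
theorem hasDerivAt_gnomonicQuat_trDil (v : Fin 3 → ℝ) (s : ℝ) :
    HasDerivAt (fun s : ℝ => gnomonicQuat (trDil (Real.exp s) v)) (gnomonicQuat (trDil (Real.exp s) v) - gnomonicQuat ![v 0, 0, 0]) s := by
  have h : HasDerivAt (fun s : ℝ => gnomonicQuat ![v 0, 0, 0] + Real.exp s • (gnomonicQuat v - gnomonicQuat ![v 0, 0, 0]))
      (Real.exp s • (gnomonicQuat v - gnomonicQuat ![v 0, 0, 0])) s := by
    have h1 := ((Real.hasDerivAt_exp s).smul_const (gnomonicQuat v - gnomonicQuat ![v 0, 0, 0])).const_add (gnomonicQuat ![v 0, 0, 0])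
    simpa using h1
  have e : (fun s : ℝ => gnomonicQuat (trDil (Real.exp s) v)) =
      fun s => gnomonicQuat ![v 0, 0, 0] + Real.exp s • (gnomonicQuat v - gnomonicQuat ![v 0, 0, 0]) :=
    funext fun s => gnomonicQuat_trDil _ v
  rw [e]
  convert h using 1
  rw [gnomonicQuat_trDil, add_sub_cancel_left]

/-- ★★ **The `x, y` letters move at speed `≤ 1/2`**: `s ↦ ν((1, trDil (e^s) v))` has `‖d/ds‖ ≤ 1/2`. [folklore] -/
theorem hasDerivAt_radialUnit_trDil (v : Fin 3 → ℝ) (s : ℝ) :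
    ∃ D : ℍ, HasDerivAt (fun s : ℝ => radialUnit (gnomonicQuat (trDil (Real.exp s) v))) D s ∧ ‖D‖ ≤ 1 / 2 := by
  have hF := hasFDerivAt_radialUnit (E := ℍ) (x := gnomonicQuat (trDil (Real.exp s) v)) (gnomonicQuat_ne_zero _)
  have h := hF.comp_hasDerivAt s (hasDerivAt_gnomonicQuat_trDil v s)
  exact ⟨_, h, norm_radialDeriv_le_half_of_inner (gnomonicQuat_ne_zero _) (inner_gnomonicQuat_trDil _ v)⟩

/-- `|gnoSign ε| = 1`. [folklore] -/
theorem abs_gnoSign (ε : Bool) : |gnoSign ε| = 1 := by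
  cases ε <;> simp [gnoSign]


/-- ★★ **The signed `x, y` letter `su2Quat (quatToSU2 (gnoLetter ε (trDil (e^s) v)))` moves at speed `≤ 1/2`.** [folklore] -/
theorem hasDerivAt_trDilLetter (ε : Bool) (v : Fin 3 → ℝ) (s : ℝ) :
    ∃ D : ℍ, HasDerivAt (fun s : ℝ => su2Quat (quatToSU2 (gnoLetter ε (trDil (Real.exp s) v)))) D s ∧ ‖D‖ ≤ 1 / 2 := by
  obtain ⟨D, hD, hle⟩ := hasDerivAt_radialUnit_trDil v s
  refine ⟨gnoSign ε • D, ?_, ?_⟩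
  · have e : (fun s : ℝ => su2Quat (quatToSU2 (gnoLetter ε (trDil (Real.exp s) v)))) = fun s => gnoSign ε • radialUnit (gnomonicQuat (trDil (Real.exp s) v)) :=
      funext fun s => by rw [gnoLetter_eq]; exact su2Quat_quatToSU2_smul_gnomonicQuat (abs_gnoSign ε) _
    rw [e]; exact hD.const_smul (gnoSign ε)
  · rw [norm_smul, Real.norm_eq_abs, abs_gnoSign, one_mul]; exact hle

/-- ★★ **The signed `z` ∕ follower letter `su2Quat (quatToSU2 (gnoLetter ε (e^s • v)))` moves at speed `≤ 1/2`** (part 1, in `gnoLetter` form). [folklore] -/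
theorem hasDerivAt_smulLetter (ε : Bool) (v : Fin 3 → ℝ) (s : ℝ) :
    ∃ D : ℍ, HasDerivAt (fun s : ℝ => su2Quat (quatToSU2 (gnoLetter ε (Real.exp s • v)))) D s ∧ ‖D‖ ≤ 1 / 2 := by
  have h := hasDerivAt_letterQuat (abs_gnoSign ε) v s
  simp only [← gnoLetter_eq] at h
  exact h

/-- A letter path built from `gnoLetter` has norm `≤ 1` (indeed `= 1`). [folklore] -/
theorem norm_su2Quat_le_one (U : Matrix.specialUnitaryGroup (Fin 2) ℂ) : ‖su2Quat U‖ ≤ 1 := (norm_su2Quat U).le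

/-! ## §3 The slaved letter `Ā·x̂·A·ẑ` and the hub -/

/-- The slaved letter through `su2Quat ∘ quatToSU2`: `su2Quat (quatToSU2 (slaveP A x · z)) = Ā · su2Quat (quatToSU2 x) · A · su2Quat (quatToSU2 z)`
for a unit `A` and non-zero `x, z`. [folklore] -/
theorem su2Quat_quatToSU2_slaveP_mul {A x z : ℍ} (hA : ‖A‖ = 1) (hx : x ≠ 0) (hz : z ≠ 0) :
    su2Quat (quatToSU2 (slaveP A x * z)) = star A * su2Quat (quatToSU2 x) * A * su2Quat (quatToSU2 z) := by
  have hP : ‖slaveP A x‖ = 1 := norm_slaveP hA hx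
  have hne : slaveP A x * z ≠ 0 := mul_ne_zero (fun h => by rw [h, norm_zero] at hP; exact zero_ne_one hP) hz
  rw [su2Quat_quatToSU2_eq_radialUnit hne, radialUnit_mul_left hP, su2Quat_quatToSU2_eq_radialUnit hx, su2Quat_quatToSU2_eq_radialUnit hz, slaveP_def]

/-- ★★ **The slaved leader letter moves at speed `≤ 1`** along the blow-up: `s ↦ su2Quat (quatToSU2 (slaveP A X_s · Z_s))` with
`X_s = gnoLetter εx (trDil (e^s) vx)`, `Z_s = gnoLetter εz (e^s • vz)`, `A` a constant unit (`‖star A‖ = ‖A‖ = 1`, speeds `1/2 + 1/2`). [folklore] -/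
theorem hasDerivAt_slavedLetter {A : ℍ} (hA : ‖A‖ = 1) (εx εz : Bool) (vx vz : Fin 3 → ℝ) (s : ℝ) :
    ∃ D : ℍ, HasDerivAt (fun s : ℝ => su2Quat (quatToSU2 (slaveP A (gnoLetter εx (trDil (Real.exp s) vx)) * gnoLetter εz (Real.exp s • vz)))) D s ∧
      ‖D‖ ≤ 1 := by
  have e : (fun s : ℝ => su2Quat (quatToSU2 (slaveP A (gnoLetter εx (trDil (Real.exp s) vx)) * gnoLetter εz (Real.exp s • vz)))) =
      fun s => (star A * su2Quat (quatToSU2 (gnoLetter εx (trDil (Real.exp s) vx))) * A) * su2Quat (quatToSU2 (gnoLetter εz (Real.exp s • vz))) :=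
    funext fun s => su2Quat_quatToSU2_slaveP_mul hA (gnoLetter_ne_zero _ _) (gnoLetter_ne_zero _ _)
  rw [e]
  -- `star A · X · A · Z` has speed `≤ 0 + 1/2 + 0 + 1/2`
  have hX1 : ∀ s : ℝ, ‖star A * su2Quat (quatToSU2 (gnoLetter εx (trDil (Real.exp s) vx)))‖ ≤ 1 := fun s =>
    (norm_mul_le _ _).trans (by rw [Quaternion.norm_star, hA, one_mul]; exact norm_su2Quat_le_one _)
  have hX2 : ∀ s : ℝ, ‖star A * su2Quat (quatToSU2 (gnoLetter εx (trDil (Real.exp s) vx))) * A‖ ≤ 1 := fun s =>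
    (norm_mul_le _ _).trans (by rw [hA, mul_one]; exact hX1 s)
  have h1 : ∃ D : ℍ, HasDerivAt (fun s : ℝ => star A * su2Quat (quatToSU2 (gnoLetter εx (trDil (Real.exp s) vx)))) D s ∧ ‖D‖ ≤ 0 + 1 / 2 :=
    exists_hasDerivAt_mul_norm_le ⟨0, hasDerivAt_const s (star A), by simp⟩ (hasDerivAt_trDilLetter εx vx s)
      (by rw [Quaternion.norm_star, hA]) (norm_su2Quat_le_one _)
  have h2 : ∃ D : ℍ, HasDerivAt (fun s : ℝ => star A * su2Quat (quatToSU2 (gnoLetter εx (trDil (Real.exp s) vx))) * A) D s ∧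
      ‖D‖ ≤ (0 + 1 / 2) + 0 :=
    exists_hasDerivAt_mul_norm_le h1 ⟨0, hasDerivAt_const s A, by simp⟩ (hX1 s) (le_of_eq hA)
  have h3 : ∃ D : ℍ, HasDerivAt (fun s : ℝ => star A * su2Quat (quatToSU2 (gnoLetter εx (trDil (Real.exp s) vx))) * A *
      su2Quat (quatToSU2 (gnoLetter εz (Real.exp s • vz)))) D s ∧ ‖D‖ ≤ ((0 + 1 / 2) + 0) + 1 / 2 :=
    exists_hasDerivAt_mul_norm_le h2 (hasDerivAt_smulLetter εz vz s) (hX2 s) (norm_su2Quat_le_one _)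
  obtain ⟨D, hD, hle⟩ := h3
  exact ⟨D, hD, by linarith⟩

/-- The hub letter is constant along the blow-up: `su2Quat (quatToSU2 A) = A` for the unit `A = ν(axisPoint a)`, `a ≠ 0`. [folklore] -/
theorem su2Quat_quatToSU2_axisUnit {a : ℍ} (ha : a ≠ 0) : su2Quat (quatToSU2 (radialUnit (axisPoint a))) = radialUnit (axisPoint a) := by
  have h1 := norm_axisUnit ha
  have hne : radialUnit (axisPoint a) ≠ 0 := fun h => by rw [h, norm_zero] at h1; exact zero_ne_one h1
  rw [su2Quat_quatToSU2_eq_radialUnit hne, radialUnit_def (radialUnit (axisPoint a)), h1, inv_one, one_smul]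

/-! ## §4 Every leader quaternion along `s ↦ blowUpPoint (e^s) (gnomonicPoint a ε η)` moves at speed `≤ 1` -/

/-- ★★ **Leader `C₀ = Q(dilate X)`** along the blow-up has speed `≤ 1/2 ≤ 1`. [folklore] -/
theorem hasDerivAt_leader_zero (a : ℍ) (εx εy εz : Bool) (vx vy vz : Fin 3 → ℝ) (s : ℝ) :
    ∃ D : ℍ, HasDerivAt (fun s : ℝ => su2Quat (leaderTuple a
        (dil3 (Real.exp s) ((gnoLetter εx vx, gnoLetter εy vy), gnoLetter εz vz)) 0)) D s ∧ ‖D‖ ≤ 1 := by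
  have e : (fun s : ℝ => su2Quat (leaderTuple a (dil3 (Real.exp s) ((gnoLetter εx vx, gnoLetter εy vy), gnoLetter εz vz)) 0)) =
      fun s => su2Quat (quatToSU2 (gnoLetter εx (trDil (Real.exp s) vx))) := by
    funext s; rw [(BlowUp.leaderTuple_apply _ _).1, dil3_apply]; simp only [dilate_gnoLetter]
  obtain ⟨D, hD, hle⟩ := hasDerivAt_trDilLetter εx vx s
  rw [e]; exact ⟨D, hD, hle.trans (by norm_num)⟩

/-- ★★ **Leader `C₁ = Q(slaveP A (dilate X) · dilateIm Z)`** (the slaved letter) along the blow-up has speed `≤ 1` (`a ≠ 0`). [folklore] -/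
theorem hasDerivAt_leader_one {a : ℍ} (ha : a ≠ 0) (εx εy εz : Bool) (vx vy vz : Fin 3 → ℝ) (s : ℝ) :
    ∃ D : ℍ, HasDerivAt (fun s : ℝ => su2Quat (leaderTuple a
        (dil3 (Real.exp s) ((gnoLetter εx vx, gnoLetter εy vy), gnoLetter εz vz)) 1)) D s ∧ ‖D‖ ≤ 1 := by
  have e : (fun s : ℝ => su2Quat (leaderTuple a (dil3 (Real.exp s) ((gnoLetter εx vx, gnoLetter εy vy), gnoLetter εz vz)) 1)) =
      fun s => su2Quat (quatToSU2 (slaveP (radialUnit (axisPoint a)) (gnoLetter εx (trDil (Real.exp s) vx)) * gnoLetter εz (Real.exp s • vz))) := by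
    funext s; rw [(BlowUp.leaderTuple_apply _ _).2.1, dil3_apply]; simp only [dilate_gnoLetter, dilateIm_gnoLetter]
  obtain ⟨D, hD, hle⟩ := hasDerivAt_slavedLetter (norm_axisUnit ha) εx εz vx vz s
  rw [e]; exact ⟨D, hD, hle⟩

/-- ★★ **Leader `C₂ = Q(dilate Y)`** along the blow-up has speed `≤ 1/2 ≤ 1`. [folklore] -/
theorem hasDerivAt_leader_two (a : ℍ) (εx εy εz : Bool) (vx vy vz : Fin 3 → ℝ) (s : ℝ) :
    ∃ D : ℍ, HasDerivAt (fun s : ℝ => su2Quat (leaderTuple a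
        (dil3 (Real.exp s) ((gnoLetter εx vx, gnoLetter εy vy), gnoLetter εz vz)) 2)) D s ∧ ‖D‖ ≤ 1 := by
  have e : (fun s : ℝ => su2Quat (leaderTuple a (dil3 (Real.exp s) ((gnoLetter εx vx, gnoLetter εy vy), gnoLetter εz vz)) 2)) =
      fun s => su2Quat (quatToSU2 (gnoLetter εy (trDil (Real.exp s) vy))) := by
    funext s; rw [(BlowUp.leaderTuple_apply _ _).2.2.1, dil3_apply]; simp only [dilate_gnoLetter]
  obtain ⟨D, hD, hle⟩ := hasDerivAt_trDilLetter εy vy s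
  rw [e]; exact ⟨D, hD, hle.trans (by norm_num)⟩

/-- ★ **The hub `c = Q(A)` is constant** along the blow-up (`a ≠ 0`): speed `0 ≤ 1`. [folklore] -/
theorem hasDerivAt_leader_three {a : ℍ} (ha : a ≠ 0) (εx εy εz : Bool) (vx vy vz : Fin 3 → ℝ) (s : ℝ) :
    ∃ D : ℍ, HasDerivAt (fun s : ℝ => su2Quat (leaderTuple a
        (dil3 (Real.exp s) ((gnoLetter εx vx, gnoLetter εy vy), gnoLetter εz vz)) 3)) D s ∧ ‖D‖ ≤ 1 := by
  have e : (fun s : ℝ => su2Quat (leaderTuple a (dil3 (Real.exp s) ((gnoLetter εx vx, gnoLetter εy vy), gnoLetter εz vz)) 3)) =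
      fun _ => radialUnit (axisPoint a) := by
    funext s; rw [(BlowUp.leaderTuple_apply _ _).2.2.2]; exact su2Quat_quatToSU2_axisUnit ha
  rw [e]; exact ⟨0, hasDerivAt_const s _, by simp⟩

/-- ★★★ **LEADER SPEEDS**: at a blow-up point in gnomonic coordinates with hub `a ≠ 0`, each of the four leader quaternions
`su2Quat (leaderTuple a (dil3 (e^s) ((X, Y), Z)) μ)` is differentiable in `s` with `‖d/ds‖ ≤ 1`; with part 1 every LINK quaternion of the rebuilt ring
(a word of `≤ 3` letters ∕ leaders) has speed `≤ 3` — the per-link input of S-B's constant `C_L`. [folklore] -/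
theorem hasDerivAt_leader_speed_le {a : ℍ} (ha : a ≠ 0) (εx εy εz : Bool) (vx vy vz : Fin 3 → ℝ) (s : ℝ) (μ : Fin 4) :
    ∃ D : ℍ, HasDerivAt (fun s : ℝ => su2Quat (leaderTuple a
        (dil3 (Real.exp s) ((gnoLetter εx vx, gnoLetter εy vy), gnoLetter εz vz)) μ)) D s ∧ ‖D‖ ≤ 1 := by
  match μ with
  | ⟨0, _⟩ => exact hasDerivAt_leader_zero a εx εy εz vx vy vz s
  | ⟨1, _⟩ => exact hasDerivAt_leader_one ha εx εy εz vx vy vz s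
  | ⟨2, _⟩ => exact hasDerivAt_leader_two a εx εy εz vx vy vz s
  | ⟨3, _⟩ => exact hasDerivAt_leader_three ha εx εy εz vx vy vz s

end Summit.QuantumFields.YangMills.Theorems.SwapVirialDeficit.Gnomonic

end
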